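import Summits.AtomisticToContinuum.HydrodynamicLimit.Theorems.RelayRaceLocalityNearConstantShortTimeHLVelObjects
import Summits.AtomisticToContinuum.HydrodynamicLimit.Theorems.RelayRaceLocalityNearConstantShortTimeHLFluxIntegrability
import HarnessLib

/-!
# Crux `NearConstantShortTimeHL` (stmt-AtomisticToContinuum-12502), line `small-tilt-domination` — the pointwise domination of
`fluctuationE` (step 1 of the conditional Gaussian chessboard estimate `stub_velocityLD`)

For positions `x`, velocities `v` and the configuration `zipConfig (x, v)`:
`fluctuationE ℓ ρ₁ θ₁ u₁ (x, v) ≤ 2(1 + c_M) ∫ (1 + ρ̃) min 1 posDev + ∫ chessIntegrand + 2 m⁻¹ Σᵢ wᵢ (Yᵢ)₊`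
(`fluctuationE_zipConfig_le`; the first integral is `smoothedDeviation`, the second carries the capped velocity terms estimated
by the chessboard, the third is linear in the one-particle kinetic fluctuations `Yᵢ = ‖vᵢ‖²/2 − ‖u₁(xᵢ)‖²/2 − 3θ₁(xᵢ)/2` with
weights `wᵢ = linWeight ∈ [0,1]`), together with the measurability / boundedness of the objects of `…VelObjects` in the centre.

References: H.-T. Yau, Lett. Math. Phys. 22 (1991) §2.
-/

noncomputable section

namespace Summit.AtomisticToContinuum.HydrodynamicLimit.Theorems.NearConstantShortTimeHL

open scoped BigOperators ENNReal
open MeasureTheory Set Filter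
open Literature.MathematicalPhysics.KineticTheory Literature.Analysis.FluidPDE Literature.Analysis.FunctionSpaces

/-! ## Measurability and bounds of the objects in the centre variable -/

/-- The ball kernel is measurable in the centre. [folklore] -/
theorem measurable_ballKernel_left (ℓ : ℝ) (z : T3) : Measurable fun y : T3 => ballKernel ℓ y z :=
  wg_measurable_ballKernel measurable_id measurable_const ℓ

/-- `ballDens` is measurable in the centre. [folklore] -/
theorem measurable_ballDens {m : ℕ} (ℓ : ℝ) (x : Fin m → T3) : Measurable fun y => ballDens ℓ x y :=
  (Finset.measurable_sum _ fun i _ => measurable_ballKernel_left ℓ (x i)).const_mul _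

/-- `velDev` is measurable in the centre. [folklore] -/
theorem measurable_velDev {m : ℕ} (ℓ : ℝ) (u₁ : T3 → V3) (x : Fin m → T3) (v : Fin m → V3) :
    Measurable fun y => velDev ℓ u₁ x v y :=
  (Finset.measurable_sum _ fun i _ => (measurable_ballKernel_left ℓ (x i)).smul_const _).fun_const_smul _

/-- `enDev` is measurable in the centre. [folklore] -/
theorem measurable_enDev {m : ℕ} (ℓ : ℝ) (θ₁ : T3 → ℝ) (u₁ : T3 → V3) (x : Fin m → T3) (v : Fin m → V3) :
    Measurable fun y => enDev ℓ θ₁ u₁ x v y :=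
  (Finset.measurable_sum _ fun i _ => (measurable_ballKernel_left ℓ (x i)).mul_const _).const_mul _

/-- `posDev` is measurable in the centre (measurable profiles). [folklore] -/
theorem measurable_posDev {m : ℕ} (ℓ : ℝ) {ρ₁ θ₁ : T3 → ℝ} {u₁ : T3 → V3} (hρ : Measurable ρ₁)
    (hθ : Measurable θ₁) (hu : Measurable u₁) (x : Fin m → T3) :
    Measurable fun y => posDev ℓ ρ₁ θ₁ u₁ x y := by
  unfold posDev totalEnergyDensity
  have hK : ∀ i, Measurable fun y : T3 => ballKernel ℓ y (x i) := fun i => measurable_ballKernel_left ℓ (x i)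
  have h1 : Measurable fun y => (m : ℝ)⁻¹ * ∑ i, ballKernel ℓ y (x i) :=
    (Finset.measurable_sum _ fun i _ => hK i).const_mul _
  have h2 : Measurable fun y => (m : ℝ)⁻¹ • ∑ i, ballKernel ℓ y (x i) • u₁ (x i) :=
    (Finset.measurable_sum _ fun i _ => (hK i).smul_const _).fun_const_smul _
  have h3 : Measurable fun y => (m : ℝ)⁻¹ * ∑ i, ballKernel ℓ y (x i) * (‖u₁ (x i)‖ ^ 2 / 2 + 3 / 2 * θ₁ (x i)) :=
    (Finset.measurable_sum _ fun i _ => (hK i).mul_const _).const_mul _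
  exact (((h1.sub hρ).pow_const 2).add ((h2.sub (hρ.smul hu)).norm.pow_const 2)).add
    ((h3.sub (hρ.mul (((hu.norm.pow_const 2).div_const 2).add (measurable_const.mul hθ)))).pow_const 2)

/-- `chessIntegrand` is measurable in the centre. [folklore] -/
theorem measurable_chessIntegrand {m : ℕ} (M ℓ : ℝ) (θ₁ : T3 → ℝ) (u₁ : T3 → V3) (x : Fin m → T3)
    (v : Fin m → V3) : Measurable fun y => chessIntegrand M ℓ θ₁ u₁ x v y := by
  unfold chessIntegrand
  have hD := measurable_ballDens ℓ x
  have hV := measurable_velDev ℓ u₁ x v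
  have hE := measurable_enDev ℓ θ₁ u₁ x v
  refine ((measurable_const.add (measurable_const.mul (measurable_const.add (measurable_const.mul hD)))).mul
    (measurable_const.min ((hV.norm.pow_const 2).add (hE.pow_const 2)))).add (measurable_const.mul ?_)
  exact Measurable.ite (measurableSet_lt measurable_const hE) hE measurable_const

/-- `0 ≤ ballDens ≤ |(4/3 π ℓ³)⁻¹|`. [folklore] -/
theorem ballDens_nonneg_le {m : ℕ} (ℓ : ℝ) (x : Fin m → T3) (y : T3) :
    0 ≤ ballDens ℓ x y ∧ ballDens ℓ x y ≤ |(4 / 3 * Real.pi * ℓ ^ 3)⁻¹| := by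
  unfold ballDens
  have h0 : 0 ≤ (m : ℝ)⁻¹ := inv_nonneg.2 (Nat.cast_nonneg m)
  refine ⟨mul_nonneg h0 (Finset.sum_nonneg fun i _ => ballKernel_nonneg ℓ y (x i)), ?_⟩
  calc (m : ℝ)⁻¹ * ∑ i, ballKernel ℓ y (x i) ≤ (m : ℝ)⁻¹ * ∑ _i : Fin m, |(4 / 3 * Real.pi * ℓ ^ 3)⁻¹| :=
        mul_le_mul_of_nonneg_left (Finset.sum_le_sum fun i _ => wg_ballKernel_le ℓ y (x i)) h0
    _ = ((m : ℝ)⁻¹ * m) * |(4 / 3 * Real.pi * ℓ ^ 3)⁻¹| := by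
        rw [Finset.sum_const, Finset.card_univ, Fintype.card_fin, nsmul_eq_mul]; ring
    _ ≤ 1 * |(4 / 3 * Real.pi * ℓ ^ 3)⁻¹| := by
        refine mul_le_mul_of_nonneg_right ?_ (abs_nonneg _)
        rcases Nat.eq_zero_or_pos m with hm | hm
        · subst hm; simp
        · rw [inv_mul_cancel₀ (by exact_mod_cast hm.ne')]
    _ = |(4 / 3 * Real.pi * ℓ ^ 3)⁻¹| := one_mul _

/-- `|enDev| ≤ |(4/3 π ℓ³)⁻¹| Σᵢ |Yᵢ|` (a bound uniform in the centre). [folklore] -/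
theorem abs_enDev_le {m : ℕ} (ℓ : ℝ) (θ₁ : T3 → ℝ) (u₁ : T3 → V3) (x : Fin m → T3) (v : Fin m → V3) (y : T3) :
    |enDev ℓ θ₁ u₁ x v y| ≤
      |(4 / 3 * Real.pi * ℓ ^ 3)⁻¹| * ∑ i, |‖v i‖ ^ 2 / 2 - ‖u₁ (x i)‖ ^ 2 / 2 - 3 / 2 * θ₁ (x i)| := by
  unfold enDev
  have h0 : 0 ≤ (m : ℝ)⁻¹ := inv_nonneg.2 (Nat.cast_nonneg m)
  have h1 : (m : ℝ)⁻¹ ≤ 1 := by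
    rcases Nat.eq_zero_or_pos m with hm | hm
    · subst hm; simp
    · exact inv_le_one_of_one_le₀ (by exact_mod_cast hm)
  rw [abs_mul, abs_of_nonneg h0, Finset.mul_sum]
  calc (m : ℝ)⁻¹ * |∑ i, ballKernel ℓ y (x i) * (‖v i‖ ^ 2 / 2 - ‖u₁ (x i)‖ ^ 2 / 2 - 3 / 2 * θ₁ (x i))|
      ≤ 1 * ∑ i, |(4 / 3 * Real.pi * ℓ ^ 3)⁻¹| * |‖v i‖ ^ 2 / 2 - ‖u₁ (x i)‖ ^ 2 / 2 - 3 / 2 * θ₁ (x i)| := by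
        refine mul_le_mul h1 ((Finset.abs_sum_le_sum_abs _ _).trans (Finset.sum_le_sum fun i _ => ?_))
          (abs_nonneg _) zero_le_one
        rw [abs_mul, abs_of_nonneg (ballKernel_nonneg ℓ y (x i))]
        exact mul_le_mul_of_nonneg_right (wg_ballKernel_le ℓ y (x i)) (abs_nonneg _)
    _ = _ := one_mul _


/-- A measurable function on `𝕋³` with a uniform bound is integrable (Haar probability measure). [folklore] -/
theorem integrable_T3_of_bound {f : T3 → ℝ} (hf : Measurable f) {C : ℝ} (hC : ∀ y, |f y| ≤ C) : Integrable f :=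
  (integrable_const C).mono' hf.aestronglyMeasurable (ae_of_all _ fun y => by simpa [Real.norm_eq_abs] using hC y)

/-! ## The pointwise domination of `fluctuationE` -/

/-- **Domination of the energy-weighted mesoscale deviation of `zipConfig (x, v)`** (first step of the conditional
Gaussian estimate): with `c_M = M²/2 + 3M/2` (`θ₁ ≤ M`, `‖u₁‖ ≤ M`, `0 ≤ M`) and `0 < ℓ < 1/2`,
`fluctuationE ℓ ρ₁ θ₁ u₁ (x, v) ≤ 2(1 + c_M) ∫ (1 + ρ̃) min 1 posDev + ∫ chessIntegrand + 2 m⁻¹ Σᵢ wᵢ (Yᵢ)₊`,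
`wᵢ = linWeight`, `Yᵢ = ‖vᵢ‖²/2 − ‖u₁(xᵢ)‖²/2 − 3θ₁(xᵢ)/2` (pointwise `weight_mul_min_one_dev_le` with
`Z = m⁻¹ Σᵢ K(y,xᵢ)(Yᵢ)₊`, integrated; the first integral is `smoothedDeviation ℓ ρ₁ θ₁ u₁ x`). [cite: Yau1991, §2] -/
theorem fluctuationE_zipConfig_le : ∀ {m : ℕ} {ℓ M : ℝ}, 0 < ℓ → ℓ < 1 / 2 → 0 ≤ M → ∀ {ρ₁ θ₁ : T3 → ℝ} {u₁ : T3 → V3}, Measurable ρ₁ → Measurable θ₁ → Measurable u₁ → (∀ y, θ₁ y ≤ M) → (∀ y, ‖u₁ y‖ ≤ M) → ∀ (x : Fin m → T3) (v : Fin m → V3), fluctuationE ℓ ρ₁ θ₁ u₁ (zipConfig (x, v)) ≤ 2 * (1 + (M ^ 2 / 2 + 3 / 2 * M)) * (∫ y, (1 + ballDens ℓ x y) * min 1 (posDev ℓ ρ₁ θ₁ u₁ x y)) + (∫ y, chessIntegrand M ℓ θ₁ u₁ x v y) + 2 * ((m : ℝ)⁻¹ * ∑ i, linWeight ℓ ρ₁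 θ₁ u₁ x i * max 0 (‖v i‖ ^ 2 / 2 - ‖u₁ (x i)‖ ^ 2 / 2 - 3 / 2 * θ₁ (x i))) := by
  intro m ℓ M hℓ0 hℓ hM ρ₁ θ₁ u₁ hρ hθ hu hθM huM x v
  -- abbreviations
  set c : ℝ := M ^ 2 / 2 + 3 / 2 * M with hc_def
  have hc : 0 ≤ c := by positivity
  set Y : Fin m → ℝ := fun i => ‖v i‖ ^ 2 / 2 - ‖u₁ (x i)‖ ^ 2 / 2 - 3 / 2 * θ₁ (x i) with hY
  set Z : T3 → ℝ := fun y => (m : ℝ)⁻¹ * ∑ i, ballKernel ℓ y (x i) * max 0 (Y i) with hZ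
  set eb : T3 → ℝ := fun y => (m : ℝ)⁻¹ * ∑ i, ballKernel ℓ y (x i) * (‖u₁ (x i)‖ ^ 2 / 2 + 3 / 2 * θ₁ (x i))
    with heb
  set mb : T3 → V3 := fun y => (m : ℝ)⁻¹ • ∑ i, ballKernel ℓ y (x i) • u₁ (x i) with hmb
  have hm0 : 0 ≤ (m : ℝ)⁻¹ := inv_nonneg.2 (Nat.cast_nonneg m)
  have hK0 : ∀ y i, 0 ≤ ballKernel ℓ y (x i) := fun y i => ballKernel_nonneg ℓ y (x i)
  -- the pointwise inequality
  have hpt : ∀ y,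
      (1 + empiricalDensityField (zipConfig (x, v)) (ballKernel ℓ y) + empiricalEnergyField (zipConfig (x, v)) (ballKernel ℓ y)) *
        min 1 ((empiricalDensityField (zipConfig (x, v)) (ballKernel ℓ y) - ρ₁ y) ^ 2 +
          ‖empiricalMomentumField (zipConfig (x, v)) (ballKernel ℓ y) - ρ₁ y • u₁ y‖ ^ 2 +
          (empiricalEnergyField (zipConfig (x, v)) (ballKernel ℓ y) - totalEnergyDensity (ρ₁ y) (u₁ y) (θ₁ y)) ^ 2) ≤
      2 * (1 + c) * ((1 + ballDens ℓ x y) * min 1 (posDev ℓ ρ₁ θ₁ u₁ x y)) +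
        chessIntegrand M ℓ θ₁ u₁ x v y + 2 * (Z y * min 1 (posDev ℓ ρ₁ θ₁ u₁ x y)) := by
    intro y
    rw [empiricalDensityField_zipConfig_ballKernel, empiricalMomentumField_zipConfig_ballKernel ℓ u₁,
      empiricalEnergyField_zipConfig_ballKernel ℓ θ₁ u₁]
    have hρ0 : 0 ≤ ballDens ℓ x y := (ballDens_nonneg_le ℓ x y).1
    have heb_le : eb y ≤ c * ballDens ℓ x y := by
      simp only [heb, ballDens, Finset.mul_sum]
      refine Finset.sum_le_sum fun i _ => ?_
      have h1 : ‖u₁ (x i)‖ ^ 2 / 2 + 3 / 2 * θ₁ (x i) ≤ c := by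
        have hu' := huM (x i)
        have hθ' := hθM (x i)
        have : ‖u₁ (x i)‖ ^ 2 ≤ M ^ 2 := pow_le_pow_left₀ (norm_nonneg _) hu' 2
        rw [hc_def]; linarith
      calc (m : ℝ)⁻¹ * (ballKernel ℓ y (x i) * (‖u₁ (x i)‖ ^ 2 / 2 + 3 / 2 * θ₁ (x i)))
          ≤ (m : ℝ)⁻¹ * (ballKernel ℓ y (x i) * c) :=
            mul_le_mul_of_nonneg_left (mul_le_mul_of_nonneg_left h1 (hK0 y i)) hm0
        _ = c * ((m : ℝ)⁻¹ * ballKernel ℓ y (x i)) := by ring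
    have hez : 0 ≤ eb y + enDev ℓ θ₁ u₁ x v y := by
      have : eb y + enDev ℓ θ₁ u₁ x v y = (m : ℝ)⁻¹ * ∑ i, ballKernel ℓ y (x i) * (‖v i‖ ^ 2 / 2) := by
        simp only [heb, enDev, ← mul_add, ← Finset.sum_add_distrib, ← mul_add]
        congr 1
        refine Finset.sum_congr rfl fun i _ => ?_
        ring
      rw [this]
      exact mul_nonneg hm0 (Finset.sum_nonneg fun i _ => mul_nonneg (hK0 y i) (by positivity))
    have hZy : max 0 (enDev ℓ θ₁ u₁ x v y) ≤ Z y := by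
      refine max_le ?_ ?_
      · exact mul_nonneg hm0 (Finset.sum_nonneg fun i _ => mul_nonneg (hK0 y i) (le_max_left _ _))
      · simp only [hZ, enDev, Finset.mul_sum]
        refine Finset.sum_le_sum fun i _ => mul_le_mul_of_nonneg_left ?_ hm0
        exact mul_le_mul_of_nonneg_left (le_max_right _ _) (hK0 y i)
    have key := weight_mul_min_one_dev_le (ρ₁ := ρ₁ y) (E₁ := totalEnergyDensity (ρ₁ y) (u₁ y) (θ₁ y))
      (mb := mb y) (μ := velDev ℓ u₁ x v y) (t := ρ₁ y • u₁ y) hρ0 heb_le hc hez hZy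
    have e1 : 1 + ballDens ℓ x y + (eb y + enDev ℓ θ₁ u₁ x v y) =
        1 + ballDens ℓ x y + ((m : ℝ)⁻¹ * ∑ i, ballKernel ℓ y (x i) * (‖u₁ (x i)‖ ^ 2 / 2 + 3 / 2 * θ₁ (x i)) +
          enDev ℓ θ₁ u₁ x v y) := rfl
    simpa only [chessIntegrand, posDev, ballDens, hc_def] using key
  -- measurability and bounds
  set B : ℝ := |(4 / 3 * Real.pi * ℓ ^ 3)⁻¹| with hB
  have hB0 : 0 ≤ B := abs_nonneg _
  have hKB : ∀ y i, ballKernel ℓ y (x i) ≤ B := fun y i => wg_ballKernel_le ℓ y (x i)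
  have hKm : ∀ i, Measurable fun y : T3 => ballKernel ℓ y (x i) := fun i => measurable_ballKernel_left ℓ (x i)
  have hDm : Measurable fun y => ballDens ℓ x y := measurable_ballDens ℓ x
  have hPm : Measurable fun y => posDev ℓ ρ₁ θ₁ u₁ x y := measurable_posDev ℓ hρ hθ hu x
  have hPm1 : Measurable fun y => min 1 (posDev ℓ ρ₁ θ₁ u₁ x y) := measurable_const.min hPm
  have hmin0 : ∀ y, 0 ≤ min 1 (posDev ℓ ρ₁ θ₁ u₁ x y) := fun y => le_min zero_le_one (by unfold posDev; positivity)
  have hmin1 : ∀ y, min 1 (posDev ℓ ρ₁ θ₁ u₁ x y) ≤ 1 := fun y => min_le_left _ _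
  have hm1 : (m : ℝ)⁻¹ ≤ 1 := by
    rcases Nat.eq_zero_or_pos m with hm | hm
    · subst hm; simp
    · exact inv_le_one_of_one_le₀ (by exact_mod_cast hm)
  -- G1
  have hG1i : Integrable fun y => (1 + ballDens ℓ x y) * min 1 (posDev ℓ ρ₁ θ₁ u₁ x y) := by
    refine integrable_T3_of_bound ((measurable_const.add hDm).mul hPm1) (C := 1 + B) fun y => ?_
    have h1 := (ballDens_nonneg_le ℓ x y).1
    have h2 := (ballDens_nonneg_le ℓ x y).2
    rw [abs_of_nonneg (mul_nonneg (by linarith) (hmin0 y))]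
    calc (1 + ballDens ℓ x y) * min 1 (posDev ℓ ρ₁ θ₁ u₁ x y) ≤ (1 + B) * 1 :=
          mul_le_mul (by linarith) (hmin1 y) (hmin0 y) (by linarith)
      _ = 1 + B := mul_one _
  -- G2
  have hG2i : Integrable fun y => chessIntegrand M ℓ θ₁ u₁ x v y := by
    refine integrable_T3_of_bound (measurable_chessIntegrand M ℓ θ₁ u₁ x v)
      (C := (2 + 2 * (1 + (1 + c) * B)) + 2 * (B * ∑ i, |Y i|)) fun y => ?_
    have h1 := (ballDens_nonneg_le ℓ x y).1
    have h2 := (ballDens_nonneg_le ℓ x y).2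
    have hE := abs_enDev_le ℓ θ₁ u₁ x v y
    have hmv0 : 0 ≤ min 1 (‖velDev ℓ u₁ x v y‖ ^ 2 + enDev ℓ θ₁ u₁ x v y ^ 2) := le_min zero_le_one (by positivity)
    have hmv1 : min 1 (‖velDev ℓ u₁ x v y‖ ^ 2 + enDev ℓ θ₁ u₁ x v y ^ 2) ≤ 1 := min_le_left _ _
    have hite0 : 0 ≤ (if 1 < enDev ℓ θ₁ u₁ x v y then enDev ℓ θ₁ u₁ x v y else 0) := by
      split_ifs with h <;> linarith
    have hite : (if 1 < enDev ℓ θ₁ u₁ x v y then enDev ℓ θ₁ u₁ x v y else 0) ≤ B * ∑ i, |Y i| := by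
      split_ifs with h
      · exact (le_abs_self _).trans hE
      · exact (abs_nonneg _).trans hE
    have hw0 : 0 ≤ 2 + 2 * (1 + (1 + c) * ballDens ℓ x y) := by positivity
    unfold chessIntegrand
    rw [abs_of_nonneg (add_nonneg (mul_nonneg hw0 hmv0) (mul_nonneg two_pos.le hite0))]
    have : (2 + 2 * (1 + (1 + c) * ballDens ℓ x y)) * min 1 (‖velDev ℓ u₁ x v y‖ ^ 2 + enDev ℓ θ₁ u₁ x v y ^ 2) ≤
        (2 + 2 * (1 + (1 + c) * B)) * 1 :=
      mul_le_mul (by nlinarith) hmv1 hmv0 (by positivity)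
    linarith
  -- G3 and the linear pieces
  have hLi : ∀ i, Integrable fun y => ballKernel ℓ y (x i) * min 1 (posDev ℓ ρ₁ θ₁ u₁ x y) := fun i => by
    refine integrable_T3_of_bound ((hKm i).mul hPm1) (C := B) fun y => ?_
    rw [abs_of_nonneg (mul_nonneg (hK0 y i) (hmin0 y))]
    calc ballKernel ℓ y (x i) * min 1 (posDev ℓ ρ₁ θ₁ u₁ x y) ≤ B * 1 := mul_le_mul (hKB y i) (hmin1 y) (hmin0 y) hB0
      _ = B := mul_one _
  have hZeq : ∀ y, Z y * min 1 (posDev ℓ ρ₁ θ₁ u₁ x y) =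
      (m : ℝ)⁻¹ * ∑ i, max 0 (Y i) * (ballKernel ℓ y (x i) * min 1 (posDev ℓ ρ₁ θ₁ u₁ x y)) := by
    intro y
    simp only [hZ, Finset.sum_mul, mul_assoc, Finset.mul_sum]
    refine Finset.sum_congr rfl fun i _ => ?_
    ring
  have hG3i : Integrable fun y => Z y * min 1 (posDev ℓ ρ₁ θ₁ u₁ x y) := by
    simp_rw [hZeq]
    exact (integrable_finsetSum _ fun i _ => (hLi i).const_mul _).const_mul _
  have hG3 : ∫ y, Z y * min 1 (posDev ℓ ρ₁ θ₁ u₁ x y) =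
      (m : ℝ)⁻¹ * ∑ i, linWeight ℓ ρ₁ θ₁ u₁ x i * max 0 (Y i) := by
    simp_rw [hZeq]
    rw [integral_const_mul, integral_finsetSum _ fun i _ => (hLi i).const_mul _]
    congr 1
    refine Finset.sum_congr rfl fun i _ => ?_
    rw [integral_const_mul, linWeight, mul_comm]
  -- integrate
  have hF0 : ∀ y, 0 ≤ (1 + empiricalDensityField (zipConfig (x, v)) (ballKernel ℓ y) +
        empiricalEnergyField (zipConfig (x, v)) (ballKernel ℓ y)) *
      min 1 ((empiricalDensityField (zipConfig (x, v)) (ballKernel ℓ y) - ρ₁ y) ^ 2 +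
        ‖empiricalMomentumField (zipConfig (x, v)) (ballKernel ℓ y) - ρ₁ y • u₁ y‖ ^ 2 +
        (empiricalEnergyField (zipConfig (x, v)) (ballKernel ℓ y) - totalEnergyDensity (ρ₁ y) (u₁ y) (θ₁ y)) ^ 2) :=
    fun y => mul_nonneg (by linarith [ballDensity_nonneg ℓ y (zipConfig (x, v)), ballEnergy_nonneg ℓ y (zipConfig (x, v))])
      (le_min zero_le_one (by positivity))
  unfold fluctuationE
  calc _ ≤ ∫ y, (2 * (1 + c) * ((1 + ballDens ℓ x y) * min 1 (posDev ℓ ρ₁ θ₁ u₁ x y)) +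
        chessIntegrand M ℓ θ₁ u₁ x v y + 2 * (Z y * min 1 (posDev ℓ ρ₁ θ₁ u₁ x y))) :=
        integral_mono_of_nonneg (ae_of_all _ hF0) (((hG1i.const_mul _).add hG2i).add (hG3i.const_mul _))
          (ae_of_all _ hpt)
    _ = 2 * (1 + c) * (∫ y, (1 + ballDens ℓ x y) * min 1 (posDev ℓ ρ₁ θ₁ u₁ x y)) +
        (∫ y, chessIntegrand M ℓ θ₁ u₁ x v y) + 2 * ∫ y, Z y * min 1 (posDev ℓ ρ₁ θ₁ u₁ x y) := by
        have e1 := integral_add (μ := (volume : Measure T3))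
          (f := fun y => 2 * (1 + c) * ((1 + ballDens ℓ x y) * min 1 (posDev ℓ ρ₁ θ₁ u₁ x y)) +
            chessIntegrand M ℓ θ₁ u₁ x v y)
          (g := fun y => 2 * (Z y * min 1 (posDev ℓ ρ₁ θ₁ u₁ x y))) ((hG1i.const_mul _).add hG2i) (hG3i.const_mul _)
        have e2 := integral_add (μ := (volume : Measure T3))
          (f := fun y => 2 * (1 + c) * ((1 + ballDens ℓ x y) * min 1 (posDev ℓ ρ₁ θ₁ u₁ x y)))
          (g := fun y => chessIntegrand M ℓ θ₁ u₁ x v y) (hG1i.const_mul _) hG2i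
        rw [e1, e2, integral_const_mul, integral_const_mul]
    _ = _ := by rw [hG3]

end Summit.AtomisticToContinuum.HydrodynamicLimit.Theorems.NearConstantShortTimeHL

end
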